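import Mathlib
import Summits.NavierStokesRegularity.NavierStokesRegularity.Theorems.WakeRatchetTailRatchetDSS
import HarnessLib

/-!
# No BACKWARD self-similar cascades: a bounded admissible eternal solution that is shell-self-similar
# with a NON-POSITIVE lag is zero; hence the DSS rung of `TailRatchet` is exactly a Liouville statement

Support lemmas for the crux `WakeRatchet.TailRatchet` (stmt-NavierStokesRegularity-21808) and the plan-only
rung `stub_rung_dss` of its registered skeleton, which quantifies over EVERY real lag `T` in
`W_{n+1}(σ) = W_n(σ − T)`.  `WakeRatchetTailRatchetDSS.no_front_of_dssRung` handled `T > 0` (the rung forbids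
those fronts below a threshold); here the other lags are disposed of unconditionally.
* `eq_zero_of_dss_nonpos_lag` — on a cancelling table, a uniformly bounded admissible eternal solution (any
  covariant viscosity `ν̂ ≥ 0`) with `W_{n+1}(σ) = W_n(σ − T)`, `T ≤ 0`, vanishes, for EVERY `ε₀ > 0`.
  Mechanism: with `T = −τ ≤ 0` the shell BELOW sits at the EARLIER phase `σ − τ`, so the renormalised energy
  `ẽ(σ) = e^{2σ}‖W_0(σ)‖²` (→ 0 as `σ → −∞` for free) obeys `ẽ' ≤ 2C_A(Λe^{2τ}‖W_0(σ)‖ + Λ⁻¹‖W_0(σ+τ)‖)·sup_{≤σ}ẽ`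
  (`hasDerivAt_renE` + cancellation); integrating against the integrable mass gives
  `sup_{≤x}ẽ ≤ δ(x)·sup_{≤x}ẽ` with `δ(x) → 0` (vanishing on a left half-line), and a Grönwall step of fixed
  length propagates the vanishing to `ℝ`.  For `T > 0` the feeding shell is at the LATER phase — the fronts.
* `dssRung_iff_noPositiveLagFront` — the statement of `stub_rung_dss` (verbatim) is EQUIVALENT to: below a
  threshold `ε₁(R) > 0`, no E₂(R) table carries a non-zero uniformly bounded admissible inviscid eternal
  solution that is shell-self-similar with a positive lag; the wake floor on `dssMu` plays no role.

MODEL lattice ODEs only (Tao 2016 §4, §6.4); nothing here concerns the Navier–Stokes equations.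
-/

noncomputable section

set_option linter.dupNamespace false

namespace Summit.NavierStokesRegularity.NavierStokesRegularity.Theorems

namespace WakeRatchetDSS

open Filter Topology MeasureTheory Set intervalIntegral
open scoped RealInnerProductSpace
open Literature.Analysis.FluidPDE Literature.Analysis.FluidPDE.TaoCascade
open WakeRatchetTail

/-! ## Real-variable helpers -/

/-- Left tails of an integrable function are small. [folklore] -/
theorem exists_Iic_integral_le {u : ℝ → ℝ} (hu : Integrable u) {δ : ℝ} (hδ : 0 < δ) :
    ∃ Z : ℝ, ∫ s in Iic Z, u s ≤ δ := by
  have hanti : Antitone (fun n : ℕ => Iic (-(n : ℝ))) := by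
    intro a b hab
    exact Iic_subset_Iic.mpr (by exact_mod_cast neg_le_neg (Nat.cast_le.mpr hab))
  have hlim := tendsto_setIntegral_of_antitone (μ := volume) (f := u)
    (fun n : ℕ => (measurableSet_Iic : MeasurableSet (Iic (-(n : ℝ))))) hanti
    ⟨0, hu.integrableOn⟩
  have hempty : (⋂ n : ℕ, Iic (-(n : ℝ))) = ∅ := by
    ext x
    simp only [mem_iInter, mem_Iic, mem_empty_iff_false, iff_false, not_forall, not_le]
    obtain ⟨n, hn⟩ := exists_nat_gt (-x)
    exact ⟨n, by linarith⟩
  rw [hempty, Measure.restrict_empty, integral_zero_measure] at hlim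
  obtain ⟨n, hn⟩ := ((tendsto_order.1 hlim).2 δ hδ).exists
  exact ⟨-(n : ℝ), hn.le⟩

/-- An interval integral of a nonnegative integrable function is dominated by a left-tail integral.
[folklore] -/
theorem intervalIntegral_le_integral_Iic {u : ℝ → ℝ} (hu : Integrable u) (hu_nn : ∀ x, 0 ≤ u x)
    {a b Z : ℝ} (hab : a ≤ b) (hbZ : b ≤ Z) : ∫ s in a..b, u s ≤ ∫ s in Iic Z, u s := by
  rw [integral_of_le hab]
  have hsub : Ioc a b ⊆ Iic Z := Ioc_subset_Iic_self.trans (Iic_subset_Iic.mpr hbZ)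
  exact setIntegral_mono_set hu.integrableOn (ae_of_all _ fun x => hu_nn x)
    (ae_of_all _ fun x hx => hsub hx)

/-- A nonnegative real number dominated by a proper fraction of itself is zero. [folklore] -/
theorem eq_zero_of_le_mul_self {m θ : ℝ} (hm : 0 ≤ m) (hθ : θ < 1) (h : m ≤ θ * m) : m = 0 := by
  nlinarith

/-! ## The backward cascade is empty -/

section Backward

variable {m : ℕ} {ε₀ νh : ℝ} {α : Fin m → Fin m → Fin m → ℤ × ℤ × ℤ → ℝ} {W : ℤ → ℝ → Em m}

/-- **No bounded admissible eternal solution is shell-self-similar with a non-positive lag.**  On a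
cancelling table, for every `ε₀ > 0` and every covariant viscosity `ν̂ ≥ 0`: if `W` is an admissible eternal
solution (`IsEternalVisc`) with `UniformBound W` and `W_{n+1}(σ) = W_n(σ − T)` for some `T ≤ 0`, then
`W ≡ 0`.  (The delay kinematics of the tree — `IsDSSWave.delay_pos`, `inv_pow_lt_dssMu` — thus lose nothing:
backward and synchronous self-similar cascades do not exist.)
[cite: Tao2016AveragedNS, §4 Lemma 4.1 (4.8)–(4.10) with (4.3), in the self-similar variables of §6.4; cell vocabulary (`IsEternalVisc`, `UniformBound`)] -/
theorem eq_zero_of_dss_nonpos_lag (hε : 0 < ε₀) (hc : IsCancellingCoeff α)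
    (hW : IsEternalVisc ε₀ νh α W) (hU : UniformBound W) {T : ℝ} (hT : T ≤ 0)
    (hD : ∀ (n : ℤ) (σ : ℝ), W (n + 1) σ = W n (σ - T)) : ∀ (n : ℤ) (σ : ℝ), W n σ = 0 := by
  have hS := table_sTable α hc
  set Λ : ℝ := bigLam ε₀ with hΛ
  have hΛpos : 0 < Λ := bigLam_pos (by linarith)
  set τ : ℝ := -T with hτdef
  have hτ : 0 ≤ τ := by rw [hτdef]; linarith
  set Φ : ℝ → Em m := W 0 with hΦdef
  have hm1 : ∀ σ : ℝ, W (-1) σ = Φ (σ - τ) := by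
    intro σ
    have h := hD (-1) (σ - τ)
    have e1 : (-1 : ℤ) + 1 = 0 := by norm_num
    rw [e1, show σ - τ - T = σ by rw [hτdef]; ring] at h
    exact h.symm
  have hp1 : ∀ σ : ℝ, W 1 σ = Φ (σ + τ) := by
    intro σ
    have h := hD 0 σ
    rw [zero_add, show σ - T = σ + τ by rw [hτdef]; ring] at h
    exact h
  obtain ⟨C, hC⟩ := hU
  have hC0 : 0 ≤ C := (norm_nonneg _).trans (hC 0 0)
  set CA : ℝ := fluxConst α with hCAdef
  have hCA : 0 ≤ CA := hS.CA_nonneg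
  have hΦc : Continuous Φ := continuous_iff_continuousAt.2 fun x => (hW.law 0 x).continuousAt
  obtain ⟨Mact, hact⟩ := hW.action
  have hint : Integrable (fun σ => ‖Φ σ‖) := (hact 0).1
  set E : ℝ → ℝ := fun x => Real.exp (2 * x) * ‖Φ x‖ ^ 2 with hEdef
  have hE0 : ∀ x, 0 ≤ E x := fun x => by positivity
  have hEle : ∀ x, E x ≤ Real.exp (2 * x) * C ^ 2 := fun x =>
    mul_le_mul_of_nonneg_left (pow_le_pow_left₀ (norm_nonneg _) (hC 0 x) 2) (Real.exp_pos _).le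
  set D : ℝ → ℝ := fun σ => Real.exp (2 * σ) * (2 * Λ * ⟪Φ σ, tableA α (Φ (σ - τ))⟫
      - 2 * Λ⁻¹ * ⟪Φ (σ + τ), tableA α (Φ σ)⟫ - 2 * viscCoef ε₀ νh 0 σ * ‖Φ σ‖ ^ 2) with hDdef
  have hderiv : ∀ σ, HasDerivAt E (D σ) σ := by
    intro σ
    have h := hasDerivAt_renE hW hc 0 σ
    simp only [zero_sub, zero_add, hm1, hp1] at h
    exact h
  have hDc : Continuous D := by
    have h1 : Continuous fun σ => Φ (σ - τ) := hΦc.comp (continuous_id.sub continuous_const)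
    have h2 : Continuous fun σ => Φ (σ + τ) := hΦc.comp (continuous_id.add continuous_const)
    have hA1 : Continuous fun σ => tableA α (Φ (σ - τ)) := hS.contA.comp h1
    have hA2 : Continuous fun σ => tableA α (Φ σ) := hS.contA.comp hΦc
    have hv : Continuous fun σ => viscCoef ε₀ νh 0 σ := by
      unfold viscCoef; fun_prop
    simp only [hDdef]
    fun_prop
  -- the running supremum of `E` on left half-lines
  set Mt : ℝ → ℝ := fun x => sSup (E '' Iic x) with hMtdef
  have hbdd : ∀ x, BddAbove (E '' Iic x) := fun x =>
    ⟨Real.exp (2 * x) * C ^ 2, by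
      rintro _ ⟨y, hy, rfl⟩
      exact (hEle y).trans (mul_le_mul_of_nonneg_right (Real.exp_le_exp.2 (by linarith [mem_Iic.1 hy]))
        (sq_nonneg C))⟩
  have hne : ∀ x, (E '' Iic x).Nonempty := fun x => ⟨E x, x, self_mem_Iic, rfl⟩
  have hMt_ge : ∀ {x y}, y ≤ x → E y ≤ Mt x := fun {x y} hy => le_csSup (hbdd x) ⟨y, hy, rfl⟩
  have hMt_nonneg : ∀ x, 0 ≤ Mt x := fun x => (hE0 x).trans (hMt_ge le_rfl)
  have hMt_mono : ∀ {x y}, y ≤ x → Mt y ≤ Mt x := fun {x y} hy =>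
    csSup_le_csSup (hbdd x) (hne y) (image_mono (Iic_subset_Iic.2 hy))
  have hMt_le : ∀ {x B}, (∀ y, y ≤ x → E y ≤ B) → Mt x ≤ B := fun {x B} h =>
    csSup_le (hne x) (by rintro _ ⟨y, hy, rfl⟩; exact h y hy)
  -- pointwise bound of the derivative on a left half-line
  set G : ℝ → ℝ := fun σ => 2 * CA * (Λ * Real.exp (2 * τ) * ‖Φ σ‖ + Λ⁻¹ * ‖Φ (σ + τ)‖) with hGdef
  have hG0 : ∀ σ, 0 ≤ G σ := fun σ => by positivity
  have hGc : Continuous G := by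
    have h2 : Continuous fun σ => Φ (σ + τ) := hΦc.comp (continuous_id.add continuous_const)
    simp only [hGdef]; fun_prop
  have hDle : ∀ {x σ}, σ ≤ x → D σ ≤ G σ * Mt x := by
    intro x σ hσ
    have hin1 : |⟪Φ σ, tableA α (Φ (σ - τ))⟫| ≤ ‖Φ σ‖ * (CA * ‖Φ (σ - τ)‖ ^ 2) :=
      (abs_real_inner_le_norm _ _).trans (mul_le_mul_of_nonneg_left (hS.normA _) (norm_nonneg _))
    have hin2 : |⟪Φ (σ + τ), tableA α (Φ σ)⟫| ≤ ‖Φ (σ + τ)‖ * (CA * ‖Φ σ‖ ^ 2) :=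
      (abs_real_inner_le_norm _ _).trans (mul_le_mul_of_nonneg_left (hS.normA _) (norm_nonneg _))
    have h1 : Real.exp (2 * σ) * (2 * Λ * ⟪Φ σ, tableA α (Φ (σ - τ))⟫)
        ≤ 2 * CA * (Λ * Real.exp (2 * τ) * ‖Φ σ‖) * Mt x := by
      have hEs : E (σ - τ) ≤ Mt x := hMt_ge (by linarith)
      have hexp : Real.exp (2 * σ) = Real.exp (2 * τ) * Real.exp (2 * (σ - τ)) := by
        rw [← Real.exp_add]; ring_nf
      calc Real.exp (2 * σ) * (2 * Λ * ⟪Φ σ, tableA α (Φ (σ - τ))⟫)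
          ≤ Real.exp (2 * σ) * (2 * Λ * (‖Φ σ‖ * (CA * ‖Φ (σ - τ)‖ ^ 2))) := by
            refine mul_le_mul_of_nonneg_left ?_ (Real.exp_pos _).le
            exact mul_le_mul_of_nonneg_left (le_abs_self _ |>.trans hin1) (by positivity)
        _ = 2 * CA * (Λ * Real.exp (2 * τ) * ‖Φ σ‖) * E (σ - τ) := by
            simp only [hEdef]; rw [hexp]; ring
        _ ≤ 2 * CA * (Λ * Real.exp (2 * τ) * ‖Φ σ‖) * Mt x :=
            mul_le_mul_of_nonneg_left hEs (by positivity)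
    have h2 : Real.exp (2 * σ) * (-(2 * Λ⁻¹ * ⟪Φ (σ + τ), tableA α (Φ σ)⟫))
        ≤ 2 * CA * (Λ⁻¹ * ‖Φ (σ + τ)‖) * Mt x := by
      have hEs : E σ ≤ Mt x := hMt_ge hσ
      have hΛi : 0 ≤ Λ⁻¹ := inv_nonneg.2 hΛpos.le
      calc Real.exp (2 * σ) * (-(2 * Λ⁻¹ * ⟪Φ (σ + τ), tableA α (Φ σ)⟫))
          ≤ Real.exp (2 * σ) * (2 * Λ⁻¹ * (‖Φ (σ + τ)‖ * (CA * ‖Φ σ‖ ^ 2))) := by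
            refine mul_le_mul_of_nonneg_left ?_ (Real.exp_pos _).le
            have := neg_abs_le ⟪Φ (σ + τ), tableA α (Φ σ)⟫
            nlinarith [hin2]
        _ = 2 * CA * (Λ⁻¹ * ‖Φ (σ + τ)‖) * E σ := by simp only [hEdef]; ring
        _ ≤ 2 * CA * (Λ⁻¹ * ‖Φ (σ + τ)‖) * Mt x :=
            mul_le_mul_of_nonneg_left hEs (by positivity)
    have h3 : 0 ≤ Real.exp (2 * σ) * (2 * viscCoef ε₀ νh 0 σ * ‖Φ σ‖ ^ 2) := by
      have : 0 ≤ viscCoef ε₀ νh 0 σ := by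
        unfold viscCoef
        exact mul_nonneg hW.nonneg (by positivity)
      positivity
    have eD : D σ = Real.exp (2 * σ) * (2 * Λ * ⟪Φ σ, tableA α (Φ (σ - τ))⟫)
        + Real.exp (2 * σ) * (-(2 * Λ⁻¹ * ⟪Φ (σ + τ), tableA α (Φ σ)⟫))
        - Real.exp (2 * σ) * (2 * viscCoef ε₀ νh 0 σ * ‖Φ σ‖ ^ 2) := by
      simp only [hDdef]; ring
    have eG : G σ * Mt x = 2 * CA * (Λ * Real.exp (2 * τ) * ‖Φ σ‖) * Mt x
        + 2 * CA * (Λ⁻¹ * ‖Φ (σ + τ)‖) * Mt x := by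
      simp only [hGdef]; ring
    rw [eD, eG]
    linarith
  -- integral form: `E x − E y ≤ (∫_y^x G) · Mt x` for `y ≤ x`
  have hkey : ∀ {x y}, y ≤ x → E x - E y ≤ (∫ s in y..x, G s) * Mt x := by
    intro x y hyx
    have hftc : ∫ s in y..x, D s = E x - E y :=
      integral_eq_sub_of_hasDerivAt (fun s _ => hderiv s) (hDc.intervalIntegrable _ _)
    rw [← hftc, ← intervalIntegral.integral_mul_const]
    refine intervalIntegral.integral_mono_on hyx (hDc.intervalIntegrable _ _)
      ((hGc.mul continuous_const).intervalIntegrable _ _) fun s hs => hDle hs.2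
  -- the integral of `G` over `[y, x]` against the left tail of the mass
  have hGint : ∀ {x y}, y ≤ x →
      ∫ s in y..x, G s ≤ 2 * CA * (Λ * Real.exp (2 * τ) + Λ⁻¹) * ∫ s in Iic (x + τ), ‖Φ s‖ := by
    intro x y hyx
    have hI1 : ∫ s in y..x, ‖Φ s‖ ≤ ∫ s in Iic (x + τ), ‖Φ s‖ :=
      intervalIntegral_le_integral_Iic hint (fun _ => norm_nonneg _) hyx (by linarith)
    have hI2 : ∫ s in y..x, ‖Φ (s + τ)‖ ≤ ∫ s in Iic (x + τ), ‖Φ s‖ := by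
      rw [intervalIntegral.integral_comp_add_right (fun s => ‖Φ s‖) τ]
      exact intervalIntegral_le_integral_Iic hint (fun _ => norm_nonneg _) (by linarith) le_rfl
    have hsplit : ∫ s in y..x, G s = 2 * CA * (Λ * Real.exp (2 * τ) * ∫ s in y..x, ‖Φ s‖)
        + 2 * CA * (Λ⁻¹ * ∫ s in y..x, ‖Φ (s + τ)‖) := by
      simp only [hGdef]
      have c1 : IntervalIntegrable (fun s => ‖Φ s‖) volume y x := hΦc.norm.intervalIntegrable _ _
      have c2 : IntervalIntegrable (fun s => ‖Φ (s + τ)‖) volume y x :=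
        (hΦc.comp (continuous_id.add continuous_const)).norm.intervalIntegrable _ _
      rw [show (fun σ => 2 * CA * (Λ * Real.exp (2 * τ) * ‖Φ σ‖ + Λ⁻¹ * ‖Φ (σ + τ)‖))
          = fun σ => (2 * CA * (Λ * Real.exp (2 * τ))) * ‖Φ σ‖ + (2 * CA * Λ⁻¹) * ‖Φ (σ + τ)‖ by
          funext σ; ring]
      rw [intervalIntegral.integral_add (c1.const_mul _) (c2.const_mul _),
        intervalIntegral.integral_const_mul, intervalIntegral.integral_const_mul]
      ring
    rw [hsplit]
    have hΛi : 0 ≤ Λ⁻¹ := inv_nonneg.2 hΛpos.le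
    have t1 : 2 * CA * (Λ * Real.exp (2 * τ) * ∫ s in y..x, ‖Φ s‖)
        ≤ 2 * CA * (Λ * Real.exp (2 * τ) * ∫ s in Iic (x + τ), ‖Φ s‖) :=
      mul_le_mul_of_nonneg_left (mul_le_mul_of_nonneg_left hI1 (by positivity)) (by positivity)
    have t2 : 2 * CA * (Λ⁻¹ * ∫ s in y..x, ‖Φ (s + τ)‖)
        ≤ 2 * CA * (Λ⁻¹ * ∫ s in Iic (x + τ), ‖Φ s‖) :=
      mul_le_mul_of_nonneg_left (mul_le_mul_of_nonneg_left hI2 hΛi) (by positivity)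
    linarith
  -- STEP 1: `Mt x ≤ δ(x) · Mt x` with `δ(x) = 2 C_A (Λe^{2τ} + Λ⁻¹) ∫_{(-∞, x+τ]} ‖Φ‖`
  have hstep1 : ∀ x, Mt x ≤ (2 * CA * (Λ * Real.exp (2 * τ) + Λ⁻¹) * ∫ s in Iic (x + τ), ‖Φ s‖) * Mt x := by
    intro x
    refine hMt_le fun x' hx' => ?_
    -- `E x' ≤ δ(x') Mt x' ≤ δ(x) Mt x`, letting the left end `y → -∞`
    have hδmono : (2 * CA * (Λ * Real.exp (2 * τ) + Λ⁻¹) * ∫ s in Iic (x' + τ), ‖Φ s‖) * Mt x'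
        ≤ (2 * CA * (Λ * Real.exp (2 * τ) + Λ⁻¹) * ∫ s in Iic (x + τ), ‖Φ s‖) * Mt x := by
      have hI : ∫ s in Iic (x' + τ), ‖Φ s‖ ≤ ∫ s in Iic (x + τ), ‖Φ s‖ :=
        setIntegral_mono_set hint.integrableOn (ae_of_all _ fun _ => norm_nonneg _)
          (ae_of_all _ (Iic_subset_Iic.2 (by linarith)))
      have hΛi : 0 ≤ Λ⁻¹ := inv_nonneg.2 hΛpos.le
      exact mul_le_mul (mul_le_mul_of_nonneg_left hI (by positivity)) (hMt_mono hx') (hMt_nonneg _)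
        (by positivity)
    refine le_trans ?_ hδmono
    refine le_of_forall_pos_lt_add fun η hη => ?_
    -- choose `y ≤ x'` with `e^{2y} C² < η`
    obtain ⟨y, hy, hyx⟩ : ∃ y, Real.exp (2 * y) * C ^ 2 < η ∧ y ≤ x' := by
      have hlim : Tendsto (fun y : ℝ => Real.exp (2 * y) * C ^ 2) atBot (𝓝 (0 * C ^ 2)) :=
        ((Real.tendsto_exp_atBot.comp (tendsto_id.const_mul_atBot (by norm_num : (0:ℝ) < 2))).mul_const _)
      rw [zero_mul] at hlim
      obtain ⟨y₀, hy₀⟩ := ((hlim.eventually (gt_mem_nhds hη)).and (eventually_le_atBot x')).exists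
      exact ⟨y₀, hy₀.1, hy₀.2⟩
    have h1 := hkey hyx
    have h2 := hGint hyx
    have h3 : (∫ s in y..x', G s) * Mt x'
        ≤ (2 * CA * (Λ * Real.exp (2 * τ) + Λ⁻¹) * ∫ s in Iic (x' + τ), ‖Φ s‖) * Mt x' :=
      mul_le_mul_of_nonneg_right h2 (hMt_nonneg _)
    linarith [hEle y]
  -- a far-left point where `δ ≤ 1/2`, hence `Mt = 0`
  have hκ : 0 ≤ 2 * CA * (Λ * Real.exp (2 * τ) + Λ⁻¹) := by
    have hΛi : 0 ≤ Λ⁻¹ := inv_nonneg.2 hΛpos.le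
    positivity
  obtain ⟨X, hX⟩ : ∃ X, Mt X = 0 := by
    obtain ⟨Z, hZ⟩ := exists_Iic_integral_le hint
      (show (0 : ℝ) < 1 / (2 * (2 * CA * (Λ * Real.exp (2 * τ) + Λ⁻¹) + 1)) by positivity)
    refine ⟨Z - τ, eq_zero_of_le_mul_self (hMt_nonneg _) (θ := 1 / 2) (by norm_num) ?_⟩
    have h := hstep1 (Z - τ)
    rw [sub_add_cancel] at h
    refine h.trans (mul_le_mul_of_nonneg_right ?_ (hMt_nonneg _))
    calc 2 * CA * (Λ * Real.exp (2 * τ) + Λ⁻¹) * ∫ s in Iic Z, ‖Φ s‖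
        ≤ 2 * CA * (Λ * Real.exp (2 * τ) + Λ⁻¹) * (1 / (2 * (2 * CA * (Λ * Real.exp (2 * τ) + Λ⁻¹) + 1))) :=
          mul_le_mul_of_nonneg_left hZ hκ
      _ ≤ 1 / 2 := by
          rw [mul_one_div, div_le_iff₀ (by positivity)]
          nlinarith
  -- STEP 2: vanishing propagates to the right by steps of a fixed length `h`
  set K : ℝ := 2 * CA * (Λ * Real.exp (2 * τ) + Λ⁻¹) * C with hKdef
  have hK : 0 ≤ K := mul_nonneg hκ hC0
  set h : ℝ := 1 / (2 * K + 1) with hhdef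
  have hh : 0 < h := by positivity
  have hhK : h * K ≤ 1 / 2 := by
    rw [hhdef, one_div_mul_eq_div, div_le_iff₀ (by positivity)]; nlinarith
  have hstep2 : ∀ x₁, Mt x₁ = 0 → Mt (x₁ + h) = 0 := by
    intro x₁ hx₁
    have hE1 : ∀ y, y ≤ x₁ → E y = 0 := fun y hy =>
      le_antisymm (by simpa [hx₁] using hMt_ge hy) (hE0 y)
    refine eq_zero_of_le_mul_self (hMt_nonneg _) (θ := 1 / 2) (by norm_num) ?_
    refine hMt_le fun x' hx' => ?_
    rcases le_or_gt x' x₁ with hle | hgt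
    · rw [hE1 x' hle]; exact mul_nonneg (by norm_num) (hMt_nonneg _)
    · have h1 := hkey hgt.le
      rw [hE1 x₁ le_rfl, sub_zero] at h1
      -- `∫_{x₁}^{x'} G ≤ h K`
      have hGK : ∫ s in x₁..x', G s ≤ h * K := by
        have hb : ∀ s ∈ Icc x₁ x', G s ≤ K := by
          intro s _
          simp only [hGdef, hKdef]
          have hΛi : 0 ≤ Λ⁻¹ := inv_nonneg.2 hΛpos.le
          have a1 : Λ * Real.exp (2 * τ) * ‖Φ s‖ ≤ Λ * Real.exp (2 * τ) * C :=
            mul_le_mul_of_nonneg_left (hC 0 s) (by positivity)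
          have a2 : Λ⁻¹ * ‖Φ (s + τ)‖ ≤ Λ⁻¹ * C := mul_le_mul_of_nonneg_left (hC 0 _) hΛi
          nlinarith
        calc ∫ s in x₁..x', G s ≤ ∫ s in x₁..x', K :=
              intervalIntegral.integral_mono_on hgt.le (hGc.intervalIntegrable _ _)
                intervalIntegrable_const hb
          _ = (x' - x₁) * K := by rw [intervalIntegral.integral_const, smul_eq_mul]
          _ ≤ h * K := mul_le_mul_of_nonneg_right (by linarith) hK
      calc E x' ≤ (∫ s in x₁..x', G s) * Mt x' := h1
        _ ≤ (h * K) * Mt (x₁ + h) :=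
            mul_le_mul hGK (hMt_mono hx') (hMt_nonneg _) (by positivity)
        _ ≤ 1 / 2 * Mt (x₁ + h) := mul_le_mul_of_nonneg_right hhK (hMt_nonneg _)
  have hall : ∀ k : ℕ, Mt (X + k * h) = 0 := by
    intro k
    induction k with
    | zero => simpa using hX
    | succ k ih =>
      have := hstep2 (X + k * h) ih
      rw [show X + ((k + 1 : ℕ) : ℝ) * h = X + k * h + h by push_cast; ring]
      exact this
  have hΦ0 : ∀ x, Φ x = 0 := by
    intro x
    obtain ⟨k, hk⟩ : ∃ k : ℕ, x ≤ X + k * h := by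
      obtain ⟨k, hk⟩ := exists_nat_ge ((x - X) / h)
      refine ⟨k, ?_⟩
      have := (div_le_iff₀ hh).1 hk
      linarith
    have hEx : E x = 0 := le_antisymm (by simpa [hall k] using hMt_ge hk) (hE0 x)
    have : ‖Φ x‖ ^ 2 = 0 := by
      simp only [hEdef] at hEx
      rcases mul_eq_zero.1 hEx with h0 | h0
      · exact absurd h0 (Real.exp_pos _).ne'
      · exact h0
    exact norm_eq_zero.1 (pow_eq_zero_iff two_ne_zero |>.1 this)
  intro n
  induction n using Int.induction_on with
  | zero => intro σ; exact hΦ0 σ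
  | succ k ih => intro σ; rw [hD k σ]; exact ih _
  | pred k ih =>
    intro σ
    have hk := hD (-(k : ℤ) - 1) (σ + T)
    rw [show -(k : ℤ) - 1 + 1 = -(k : ℤ) by ring, add_sub_cancel_right] at hk
    rw [← hk]
    exact ih _

end Backward

/-! ## The DSS rung is exactly the positive-lag Liouville statement -/

/-- **`stub_rung_dss` ⟺ no positive-lag fronts below threshold.**  The statement of the plan-only rung
`stub_rung_dss` of the registered skeleton of `TailRatchet` (left side, quoted verbatim: the tail ratchet for
uniformly bounded admissible inviscid eternal solutions that are shell-self-similar with ANY real lag) is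
equivalent to the Liouville statement (right side): below a threshold `ε₁(R) > 0` no E₂(R) table carries a
non-zero uniformly bounded admissible inviscid eternal solution that is shell-self-similar with a POSITIVE
lag.  (→) is `no_front_of_dssRung`; (←) holds with any rate, e.g. `w = 1/2`, because non-positive lags carry
only the zero solution (`eq_zero_of_dss_nonpos_lag`) and positive lags are excluded by hypothesis — the wake
floor `dssMu ≤ 1 − w` is never invoked.
[cite: Tao2016AveragedNS, §4 Thm. 4.2 (statement shape), Lemma 4.1 (4.8)–(4.10), §6.4; cell vocabulary] -/
theorem dssRung_iff_noPositiveLagFront :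
    (∀ R : ℝ, 1 ≤ R → ∃ w : ℝ, 0 < w ∧ ∃ εs : ℝ, 0 < εs ∧ ∀ ε₀ : ℝ, 0 < ε₀ → ε₀ ≤ εs →
      ∀ α : Fin 4 → Fin 4 → Fin 4 → ℤ × ℤ × ℤ → ℝ, InTableClass R α →
        ∀ (W : ℤ → ℝ → Em 4) (T : ℝ), IsEternal ε₀ α W → UniformBound W →
          (∀ (n : ℤ) (σ : ℝ), W (n + 1) σ = W n (σ - T)) →
          ∀ (n : ℤ) (M : ℝ), (∀ σ : ℝ, ∑' k : ℕ, physEnergy ε₀ W (n + k) σ ≤ M) →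
            ∀ σ : ℝ, ∑' k : ℕ, physEnergy ε₀ W (n + 1 + k) σ ≤ (1 - w) * M) ↔
    (∀ R : ℝ, 1 ≤ R → ∃ ε₁ : ℝ, 0 < ε₁ ∧ ∀ ε₀ : ℝ, 0 < ε₀ → ε₀ ≤ ε₁ →
      ∀ α : Fin 4 → Fin 4 → Fin 4 → ℤ × ℤ × ℤ → ℝ, InTableClass R α →
        ∀ (W : ℤ → ℝ → Em 4) (T : ℝ), 0 < T → IsEternal ε₀ α W → UniformBound W →
          (∀ (n : ℤ) (σ : ℝ), W (n + 1) σ = W n (σ - T)) → ∀ (n : ℤ) (σ : ℝ), W n σ = 0) := by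
  constructor
  · exact no_front_of_dssRung
  · intro h R hR
    obtain ⟨ε₁, hε₁, H⟩ := h R hR
    refine ⟨1 / 2, by norm_num, ε₁, hε₁, ?_⟩
    intro ε₀ hε₀ hle α hα W T hW hU hD n M hM σ
    have hzero : ∀ (k : ℤ) (s : ℝ), W k s = 0 := by
      rcases lt_or_ge 0 T with hT | hT
      · exact H ε₀ hε₀ hle α hα W T hT hW hU hD
      · exact eq_zero_of_dss_nonpos_lag hε₀ hα.2.1 hW.isEternalVisc hU hT hD
    have hM0 : 0 ≤ M :=
      (tsum_nonneg fun k : ℕ => physEnergy_nonneg ε₀ W (n + (k : ℤ)) σ).trans (hM σ)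
    have hsum : ∑' k : ℕ, physEnergy ε₀ W (n + 1 + k) σ = 0 := by
      have : (fun k : ℕ => physEnergy ε₀ W (n + 1 + k) σ) = fun _ => 0 := by
        funext k; simp [physEnergy, hzero]
      rw [this, tsum_zero]
    rw [hsum]
    exact mul_nonneg (by norm_num) hM0

end WakeRatchetDSS

end Summit.NavierStokesRegularity.NavierStokesRegularity.Theorems

end
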